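import Mathlib
import HarnessLib
import Summits.HubbardSuperconductivity.HubbardSuperconductivity.Theorems.WeakCouplingBCSKlCertTPrimeConvexHS
import Summits.HubbardSuperconductivity.HubbardSuperconductivity.Theorems.WeakCouplingBCSKlCertTPrimeCurvatureQuadraticFarGamma

/-!
# Route `WeakCouplingBCS` — certificate half of stmt-HubbardSuperconductivity-0158, item «CONVEX-WINDOW-HS», file S3:
# the `χ₀` HILBERT–SCHMIDT CHART of the `t`–`t′` band (`−1/2 < t′ < 0`): BOTH convex sides of the convexity chart, and the scan rows

Cell `gate-hubbard-kl`, seat p4 (g24); zero kit; no definitions.  The convexity chart ✓ `KlTPrimeConvexity.convexityChart` says where the Fermi curve of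
`ε_{t′}` is strictly convex: the FAR-Γ SIDE `−4 − 4t′ < μ < μ_c(t′) = 8t′ − 16t′³` (✓ `farGamma_curvNum_pos`) and the M SIDE `4t′ < μ < 4t′ + 32|t′|(1 − 4t′²)`
(✓ `Mside_curvNum_neg`); in between lies the inflection band.  On both convex sides the Hilbert–Schmidt row of the Lindhard kernel is now a THEOREM:

* **`kltp_HS_farGamma (htp1) (htp0) (hbot : −4 − 4t′ < μ) (hμc : μ < convexityReturnLevel t′)`** — Γ side directly (✓ `kltp_HS_of_convex'`, S2);
* **`kltp_HS_convexChart`** — the two convex arms of the chart carry the HS row (M side: ✓ `kltp_HS_Mside`, S2);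
* the SCAN ROWS of KL-MARGIN-SCAN by `norm_num`: `kltp_HS_row_tpm03` (μ ∈ (−6/5, 0)), `kltp_HS_row_tpm02` (μ ∈ (−4/5, 0)), `kltp_HS_row_tpm01` (μ ∈ (−2/5, 0)),
  `kltp_HS_farGamma_row_tpm01` (μ ∈ (−18/5, −98/125)) — the HS twins of ✓ `Mside_row_tpm03/02/01`, ✓ `farGamma_row_tpm01`; every DECIDED M-side / far-Γ
  cell's μ-bracket lies inside one of them.

HONEST LABEL: Hilbert–Schmidt rows only (the analytic input `hHS` of any `t′` record); the inflection band `(μ_c(t′), 4t′)` is NOT covered (there the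
six-quantity alternative fails, idea-2 g17 card e1b90ab4d4d7b143); records stay conditional on their certified enclosures; nothing DECIDED moves; nothing
about `K₃`, `U₀`, the window or superconductivity; a Kohn–Luttinger `O(U²)` channel statement is not ODLRO; nothing here proves superconductivity in the
Hubbard model.
References: S. Raghu, S. A. Kivelson, D. J. Scalapino, Phys. Rev. B 81 (2010) 224505, §II (5)–(8), §III Fig. 3; S. Fratini, F. Guinea,
Phys. Rev. B 66 (2002) 125104, App. A.
-/

noncomputable section

-- the tree's namespace `Summit.<Summit>.<Problem>.Theorems` repeats the summit name by design (D-0017)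
set_option linter.dupNamespace false

namespace Summit.HubbardSuperconductivity.HubbardSuperconductivity.Theorems

open Real Set Filter MeasureTheory Literature.MathematicalPhysics.QuantumLattice KlTPrimeConvexity
open scoped Topology ENNReal

/-! ### §1 The far-Γ side and the chart -/

/-- **THE HILBERT–SCHMIDT ROW ON THE FAR-Γ SIDE**: for `−1/2 < t′ < 0` and `−4 − 4t′ < μ < μ_c(t′)`, `χ₀[ε_{t′}, μ](· + ·) ∈ L²(σ ⊗ σ)`
(strict convexity ✓ `farGamma_curvNum_pos`; `μ_c(t′) < 4t′` ✓ `convexityReturnLevel_lt_vanHove`). [cite: RaghuKivelsonScalapino2010, §II (5)-(8)] -/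
theorem kltp_HS_farGamma {tp μ : ℝ} (htp1 : -1 / 2 < tp) (htp0 : tp < 0) (hbot : -4 - 4 * tp < μ) (hμc : μ < convexityReturnLevel tp) :
    MemLp (fun z : Momentum × Momentum => lindhardFunction (squareDispersion 1 tp) μ (z.1 + z.2)) 2
      ((fermiCurveMeasure (squareDispersion 1 tp) μ).prod (fermiCurveMeasure (squareDispersion 1 tp) μ)) :=
  kltp_HS_of_convex' (abs_lt.2 ⟨by linarith, by linarith⟩) hbot (hμc.trans (convexityReturnLevel_lt_vanHove htp1 htp0))
    fun _ hk => farGamma_curvNum_pos htp1 htp0 hbot hμc hk.2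

/-- **THE HILBERT–SCHMIDT CHART** (`−1/2 < t′ < 0`): on BOTH convex arms of ✓ `convexityChart` — the far-Γ side `−4 − 4t′ < μ < μ_c(t′)` and the M side
`4t′ < μ < min(4 − 4t′, 4t′ + 32|t′|(1 − 4t′²))` — the `χ₀` Hilbert–Schmidt row holds with no further hypothesis. [cite: RaghuKivelsonScalapino2010, §II (5)-(8)] -/
theorem kltp_HS_convexChart {tp μ : ℝ} (htp1 : -1 / 2 < tp) (htp0 : tp < 0) :
    (-4 - 4 * tp < μ → μ < convexityReturnLevel tp →
      MemLp (fun z : Momentum × Momentum => lindhardFunction (squareDispersion 1 tp) μ (z.1 + z.2)) 2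
        ((fermiCurveMeasure (squareDispersion 1 tp) μ).prod (fermiCurveMeasure (squareDispersion 1 tp) μ))) ∧
    (4 * tp < μ → μ < 4 - 4 * tp → μ - 4 * tp < 32 * |tp| * (1 - 4 * tp ^ 2) →
      MemLp (fun z : Momentum × Momentum => lindhardFunction (squareDispersion 1 tp) μ (z.1 + z.2)) 2
        ((fermiCurveMeasure (squareDispersion 1 tp) μ).prod (fermiCurveMeasure (squareDispersion 1 tp) μ))) :=
  ⟨fun hbot hμc => kltp_HS_farGamma htp1 htp0 hbot hμc, fun hvh htop hdisc => kltp_HS_Mside htp1 htp0 hvh htop hdisc⟩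

/-! ### §2 The scan rows -/

/-- Scan row `t′ = −0.3`, M side: the HS row at every level `μ ∈ (−6/5, 0)` (⊃ the brackets of the cells `δ ∈ {0.05, …, 0.25}`, in particular the
`(⅛, −0.3)` records' box). [cite: RaghuKivelsonScalapino2010, §II (5)-(8)] -/
theorem kltp_HS_row_tpm03 {μ : ℝ} (hμ : μ ∈ Set.Ioo (-6 / 5 : ℝ) 0) :
    MemLp (fun z : Momentum × Momentum => lindhardFunction (squareDispersion 1 (-3 / 10)) μ (z.1 + z.2)) 2
      ((fermiCurveMeasure (squareDispersion 1 (-3 / 10)) μ).prod (fermiCurveMeasure (squareDispersion 1 (-3 / 10)) μ)) := by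
  obtain ⟨h1, h2⟩ := hμ
  have hdisc : μ - 4 * (-3 / 10 : ℝ) < 32 * |(-3 / 10 : ℝ)| * (1 - 4 * (-3 / 10 : ℝ) ^ 2) := by
    rw [abs_of_neg (by norm_num)]; nlinarith
  exact kltp_HS_Mside (by norm_num) (by norm_num) (by linarith) (by linarith) hdisc

/-- Scan row `t′ = −0.2`, M side: the HS row at every level `μ ∈ (−4/5, 0)`. [cite: RaghuKivelsonScalapino2010, §II (5)-(8)] -/
theorem kltp_HS_row_tpm02 {μ : ℝ} (hμ : μ ∈ Set.Ioo (-4 / 5 : ℝ) 0) :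
    MemLp (fun z : Momentum × Momentum => lindhardFunction (squareDispersion 1 (-2 / 10)) μ (z.1 + z.2)) 2
      ((fermiCurveMeasure (squareDispersion 1 (-2 / 10)) μ).prod (fermiCurveMeasure (squareDispersion 1 (-2 / 10)) μ)) := by
  obtain ⟨h1, h2⟩ := hμ
  have hdisc : μ - 4 * (-2 / 10 : ℝ) < 32 * |(-2 / 10 : ℝ)| * (1 - 4 * (-2 / 10 : ℝ) ^ 2) := by
    rw [abs_of_neg (by norm_num)]; nlinarith
  exact kltp_HS_Mside (by norm_num) (by norm_num) (by linarith) (by linarith) hdisc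

/-- Scan row `t′ = −0.1`, M side: the HS row at every level `μ ∈ (−2/5, 0)`. [cite: RaghuKivelsonScalapino2010, §II (5)-(8)] -/
theorem kltp_HS_row_tpm01 {μ : ℝ} (hμ : μ ∈ Set.Ioo (-2 / 5 : ℝ) 0) :
    MemLp (fun z : Momentum × Momentum => lindhardFunction (squareDispersion 1 (-1 / 10)) μ (z.1 + z.2)) 2
      ((fermiCurveMeasure (squareDispersion 1 (-1 / 10)) μ).prod (fermiCurveMeasure (squareDispersion 1 (-1 / 10)) μ)) := by
  obtain ⟨h1, h2⟩ := hμ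
  have hdisc : μ - 4 * (-1 / 10 : ℝ) < 32 * |(-1 / 10 : ℝ)| * (1 - 4 * (-1 / 10 : ℝ) ^ 2) := by
    rw [abs_of_neg (by norm_num)]; nlinarith
  exact kltp_HS_Mside (by norm_num) (by norm_num) (by linarith) (by linarith) hdisc

/-- Scan row `t′ = −0.1`, far Γ side: the HS row at every level `μ ∈ (−18/5, −98/125)` (cells `δ ∈ {0.275, …, 0.35}`). [cite: RaghuKivelsonScalapino2010, §II (5)-(8)] -/
theorem kltp_HS_farGamma_row_tpm01 {μ : ℝ} (hμ : μ ∈ Set.Ioo (-18 / 5 : ℝ) (-98 / 125)) :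
    MemLp (fun z : Momentum × Momentum => lindhardFunction (squareDispersion 1 (-1 / 10)) μ (z.1 + z.2)) 2
      ((fermiCurveMeasure (squareDispersion 1 (-1 / 10)) μ).prod (fermiCurveMeasure (squareDispersion 1 (-1 / 10)) μ)) := by
  obtain ⟨h1, h2⟩ := hμ
  have hμc : μ < convexityReturnLevel (-1 / 10) := by rw [convexityReturnLevel_m01]; linarith
  exact kltp_HS_farGamma (by norm_num) (by norm_num) (by linarith) hμc

end Summit.HubbardSuperconductivity.HubbardSuperconductivity.Theorems

end
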